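import Summits.CriticalPhenomena.PercolationContinuityZ3.Theorems.PercNearOneGluingAdditiveGluingMultiEdgeLemma3
import HarnessLib

/-! # Crux `PercNearOneGluing.AdditiveGluing` (stmt-CriticalPhenomena-4576) — the δ-versions of the gluing Lemma 5 and of the
# multi-edge Lemma 3 (strategy (b): the quantitative tools of the T-form certificate calculus)

Support file (`--supports stmt-CriticalPhenomena-4576`); no definitions, no named facts.  Companion of
`…AdditiveGluingMultiEdgeLemma3.lean`.

`μ_w = prodBernoulli w` on the bond configurations of `Fin n`, target `b`, `τ(v) = μ(v ↔ b)`.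

* `glueEdges_lemma5_delta` — **KN Lemma 5 with slack, for an arbitrary glued edge set `D`** whose "all open" event is increasing in the
  open edge cluster of `v` (cliques: `gluingLemma5_allOpen_mono`; stars: `starGlue_allOpen_mono`): `τ(c) ≤ τ(v) + δ` ⟹
  `τ_glue(c) ≤ τ_glue(v) + δ` (`glue` = weight `1` on `D`).  Printed source: Lemma 5 is proved from Lemma 3(i), whose printed form
  carries the slack `δ` ("`P(a₁ ↔ b) < P(a₂ ↔ b) + δ` ⟹ `P(a₁ ↔ b | Q) < P(a₂ ↔ b | Q) + δ`", p. 6).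
* `glueBlock_lemma5_delta`, `starGlue_lemma5_delta` — the clique and star instances.
* `multiEdge_lemma3_delta` — the multi-edge Lemma 3 with FLAT slack: `τ(d) ≤ τ(a) + δ` for all `a ∈ T` ⟹
  `μ(R ∩ {d ↔ b}) ≤ μ(R ∩ {x ↔ b}) + δ` (same proof as `multiEdge_lemma3`; the slack enters once, through the comparison of `d` with the
  `τ⁰`-minimiser `c`).  (The sharp form `+ δ·μ(R)` holds numerically — seat-b lab/ml3_delta.py, worst ratio 1.000 at `|T| = 1` — and is
  KN's for `|T| = 1`; it is not claimed here.)
These are exactly the two "penalty" moves of the seat-b certificate calculus for AG (memo TFormCalculus-b.md §3: a designation that is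
below a relay neighbour only up to `δ` costs at most `δ`).
[cite: KozmaNitzan2024, Lemma 3(i) (pp. 6–7), Lemma 5 (p. 13)]
-/

namespace Summit.CriticalPhenomena.PercolationContinuityZ3.Theorems

open MeasureTheory Set
open Literature.Probability.LatticeModels (prodBernoulli)
open Literature.Probability.Percolation (BondConfig openConn openGraph openEdgeCluster pinW localCylinder
  DeterminedBy determinedBy_iff)

noncomputable section
open Classical

section GlueDelta

open Filter Topology Literature.Probability.LatticeModels Literature.Probability.Percolation

variable {n : ℕ}

/-- **KN Lemma 5 with slack `δ`, for an arbitrary glued edge set `D`** whose "all of `D` open" event is increasing in `C_v`: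
`μ_w(c ↔ b) ≤ μ_w(v ↔ b) + δ` ⟹ `μ_glue(c ↔ b) ≤ μ_glue(v ↔ b) + δ`.  Proof = the landed `stub_gluingLemma5` / `starGlue_lemma5`
(sprinkle `ε` on `D`, `knLemma3i` with slack `δ + d(ε)`, condition = glue, `ε → 0`).
[cite: KozmaNitzan2024, Lemma 5 (p. 13), Lemma 3(i) (pp. 6–7)] -/
theorem glueEdges_lemma5_delta (w : Sym2 (Fin n) → unitInterval) (D : Finset (Sym2 (Fin n))) (c v b : Fin n)
    (hmono : ∀ ω ω' : Set (Sym2 (Fin n)),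
      ω ∈ {ω : Set (Sym2 (Fin n)) | (↑D : Set (Sym2 (Fin n))) ⊆ ω} →
        openEdgeCluster ω v ⊆ openEdgeCluster ω' v →
          ω' ∈ {ω : Set (Sym2 (Fin n)) | (↑D : Set (Sym2 (Fin n))) ⊆ ω})
    {δ : ℝ} (hδ : 0 ≤ δ)
    (hle : (prodBernoulli w).real (openConn c b) ≤ (prodBernoulli w).real (openConn v b) + δ) :
    (prodBernoulli (fun e : Sym2 (Fin n) => if e ∈ D then 1 else w e)).real (openConn c b) ≤
      (prodBernoulli (fun e : Sym2 (Fin n) => if e ∈ D then 1 else w e)).real (openConn v b) + δ := by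
  set g : Sym2 (Fin n) → unitInterval := fun e => if e ∈ D then 1 else w e with hg
  set E : Set (BondConfig (Fin n)) := {ω | (↑D : Set (Sym2 (Fin n))) ⊆ ω} with hEdef
  -- the sprinkled weights `w_ε`
  set u : unitInterval → Sym2 (Fin n) → unitInterval :=
    fun ε e => if e ∈ D then Set.Icc.convexComb (w e) 1 ε else w e with hu
  have hwu : ∀ ε, w ≤ u ε := by
    intro ε e
    by_cases he : e ∈ D
    · simp only [hu, he, if_true]
      exact Set.Icc.le_convexComb unitInterval.le_one' ε
    · simp only [hu, he, if_false]
      exact le_rfl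
  have hu0 : u 0 = w := by
    funext e
    by_cases he : e ∈ D
    · simp only [hu, he, if_true, Set.Icc.convexComb_zero]
    · simp only [hu, he, if_false]
  have hucont : Continuous u := by
    refine continuous_pi fun e => ?_
    by_cases he : e ∈ D
    · simp only [hu, he, if_true]
      exact Set.Icc.continuous_convexComb (w e) 1
    · simp only [hu, he, if_false]
      exact continuous_const
  -- gluing `u ε` along `D` gives `g`, whatever `ε`
  have hpin : ∀ ε, (fun e => if e ∈ D then (1 : unitInterval) else u ε e) = g := by
    intro ε
    funext e
    by_cases he : e ∈ D
    · simp only [hg, he, if_true]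
    · simp only [hg, hu, he, if_false]
  -- conditioning on `E` is gluing
  have hcond : ∀ ε (X : Set (BondConfig (Fin n))),
      (prodBernoulli (u ε)).real (X ∩ E) =
        (prodBernoulli (u ε)).real E * (prodBernoulli g).real X := by
    intro ε X
    rw [hEdef, gluingLemma5_real_inter_allOpen (u ε) D MeasurableSet.of_discrete, hpin ε]
  -- `E` has positive probability under `u ε`, `ε > 0`
  have hpos : ∀ ε : unitInterval, 0 < (ε : ℝ) → 0 < (prodBernoulli (u ε)).real E := by
    intro ε hε
    rw [hEdef, prodBernoulli_real_subset (u ε) D]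
    refine Finset.prod_pos fun e he => ?_
    simp only [hu, he, if_true, Set.Icc.coe_convexComb, Set.Icc.coe_one, mul_one]
    exact add_pos_of_nonneg_of_pos
      (mul_nonneg (unitInterval.one_minus_nonneg ε) (unitInterval.nonneg (w e))) hε
  -- the step at fixed `ε > 0`
  have hstep : ∀ ε : unitInterval, 0 < (ε : ℝ) →
      (prodBernoulli g).real (openConn c b) ≤ (prodBernoulli g).real (openConn v b) +
        (δ + ((prodBernoulli (u ε)).real (openConn c b) - (prodBernoulli w).real (openConn c b))) := by
    intro ε hε
    have hma : (prodBernoulli w).real (openConn c b) ≤ (prodBernoulli (u ε)).real (openConn c b) :=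
      prodBernoulli_real_mono_of_isUpperSet (hwu ε) (isUpperSet_openConn c b)
        MeasurableSet.of_discrete
    have hmv : (prodBernoulli w).real (openConn v b) ≤ (prodBernoulli (u ε)).real (openConn v b) :=
      prodBernoulli_real_mono_of_isUpperSet (hwu ε) (isUpperSet_openConn v b)
        MeasurableSet.of_discrete
    have h3 := knLemma3i n (u ε) c v b E
      (δ + ((prodBernoulli (u ε)).real (openConn c b) - (prodBernoulli w).real (openConn c b)))
      hmono (add_nonneg hδ (sub_nonneg.2 hma)) (by linarith)
    rw [hcond ε (openConn c b), hcond ε (openConn v b)] at h3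
    refine le_of_mul_le_mul_left (h3.trans_eq ?_) (hpos ε hε)
    ring
  -- `ε → 0`
  obtain ⟨ε, hεpos, hεlim⟩ := gluingLemma5_exists_seq_tendsto_zero
  have hF : Continuous fun t : unitInterval => (prodBernoulli (u t)).real (openConn c b) :=
    (stub_weightContinuity n (openConn c b)).comp hucont
  have hlim : Tendsto (fun k => (prodBernoulli g).real (openConn v b) +
      (δ + ((prodBernoulli (u (ε k))).real (openConn c b) - (prodBernoulli w).real (openConn c b))))
      atTop (𝓝 ((prodBernoulli g).real (openConn v b) +
        (δ + ((prodBernoulli (u 0)).real (openConn c b) - (prodBernoulli w).real (openConn c b))))) :=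
    tendsto_const_nhds.add (tendsto_const_nhds.add (((hF.tendsto 0).comp hεlim).sub tendsto_const_nhds))
  rw [hu0, sub_self, add_zero] at hlim
  exact ge_of_tendsto' hlim fun k => hstep (ε k) (hεpos k)


/-- Star instance of `glueEdges_lemma5_delta` (`D` a set of edges at `x`, `v` an endpoint).
[cite: KozmaNitzan2024, Lemma 5 (p. 13)] -/
theorem starGlue_lemma5_delta (w : Sym2 (Fin n) → unitInterval) (x : Fin n) (D : Finset (Sym2 (Fin n)))
    (hD : ∀ e ∈ D, ∃ a, a ≠ x ∧ e = s(x, a)) (c v b : Fin n) (hv : s(x, v) ∈ D) (hvx : v ≠ x) {δ : ℝ} (hδ : 0 ≤ δ)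
    (hle : (prodBernoulli w).real (openConn c b) ≤ (prodBernoulli w).real (openConn v b) + δ) :
    (prodBernoulli (fun e : Sym2 (Fin n) => if e ∈ D then 1 else w e)).real (openConn c b) ≤
      (prodBernoulli (fun e : Sym2 (Fin n) => if e ∈ D then 1 else w e)).real (openConn v b) + δ :=
  glueEdges_lemma5_delta w D c v b (starGlue_allOpen_mono hD hv hvx) hδ hle

/-- Clique instance of `glueEdges_lemma5_delta` = the landed `stub_gluingLemma5` with slack: `v ∈ S`, `τ(c) ≤ τ(v) + δ` ⟹ after gluing
the block `S`, `τ(c) ≤ τ(S) + δ` (`τ(S)` = `μ(⋃_{s∈S} s ↔ b)`).  This is the `δ`-leaf of the T-form calculus: a block containing a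
vertex that is above the designation up to `δ` costs at most `δ`. [cite: KozmaNitzan2024, Lemma 5 (p. 13)] -/
theorem glueBlock_lemma5_delta (w : Sym2 (Fin n) → unitInterval) (S : Finset (Fin n)) (c v b : Fin n) (hvS : v ∈ S)
    {δ : ℝ} (hδ : 0 ≤ δ)
    (hle : (prodBernoulli w).real (openConn c b) ≤ (prodBernoulli w).real (openConn v b) + δ) :
    (prodBernoulli (fun e : Sym2 (Fin n) => if (∀ y ∈ e, y ∈ S) ∧ ¬ e.IsDiag then 1 else w e)).real (openConn c b) ≤
      (prodBernoulli (fun e : Sym2 (Fin n) => if (∀ y ∈ e, y ∈ S) ∧ ¬ e.IsDiag then 1 else w e)).real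
        (⋃ s ∈ S, openConn s b) + δ := by
  set D : Finset (Sym2 (Fin n)) := Finset.univ.filter (fun e => (∀ y ∈ e, y ∈ S) ∧ ¬ e.IsDiag) with hDdef
  have hD : ∀ e, e ∈ D ↔ (∀ y ∈ e, y ∈ S) ∧ ¬ e.IsDiag := fun e => by simp [hDdef]
  have hg : (fun e : Sym2 (Fin n) => if (∀ y ∈ e, y ∈ S) ∧ ¬ e.IsDiag then (1 : unitInterval) else w e) =
      fun e => if e ∈ D then 1 else w e := by
    funext e
    by_cases he : (∀ y ∈ e, y ∈ S) ∧ ¬ e.IsDiag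
    · rw [if_pos he, if_pos ((hD e).2 he)]
    · rw [if_neg he, if_neg (fun h => he ((hD e).1 h))]
  rw [hg]
  refine (glueEdges_lemma5_delta w D c v b (gluingLemma5_allOpen_mono hD hvS) hδ hle).trans ?_
  have hmono : (prodBernoulli fun e : Sym2 (Fin n) => if e ∈ D then (1 : unitInterval) else w e).real (openConn v b) ≤
      (prodBernoulli fun e : Sym2 (Fin n) => if e ∈ D then (1 : unitInterval) else w e).real (⋃ s ∈ S, openConn s b) :=
    measureReal_mono (fun ω hω => Set.mem_iUnion₂.2 ⟨v, hvS, hω⟩) (measure_ne_top _ _)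
  linarith

end GlueDelta

section MultiEdgeDelta

open Literature.Probability.LatticeModels Literature.Probability.Percolation

variable {n : ℕ}

/-- **Multi-edge Lemma 3 with flat slack.**  `x ∉ T`, `τ(d) ≤ τ(a) + δ` for every `a ∈ T` (`δ ≥ 0`), `R` = some edge `x–T`
open ⟹ `μ(R ∩ {d ↔ b}) ≤ μ(R ∩ {x ↔ b}) + δ`.  Proof as `multiEdge_lemma3`: with `c` the `τ⁰`-minimiser over `{d} ∪ T`,
`μ(R, d b) = τ(d) − μ[∅]τ⁰(d) ≤ τ(c) + δ − μ[∅]τ⁰(c) = μ(R, c b) + δ ≤ μ(R, x b) + δ` (`multiEdge_core`).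
[cite: KozmaNitzan2024, Lemma 3(i) (pp. 6–7), Lemma 5 (p. 13)] -/
theorem multiEdge_lemma3_delta (w : Sym2 (Fin n) → unitInterval) (x d b : Fin n) (T : Finset (Fin n))
    (hxT : x ∉ T) {δ : ℝ} (hδ : 0 ≤ δ)
    (hle : ∀ a ∈ T, (prodBernoulli w).real (openConn d b) ≤ (prodBernoulli w).real (openConn a b) + δ) :
    (prodBernoulli w).real ({ω : Set (Sym2 (Fin n)) | ∃ a ∈ T, s(x, a) ∈ ω} ∩ openConn d b) ≤
      (prodBernoulli w).real ({ω : Set (Sym2 (Fin n)) | ∃ a ∈ T, s(x, a) ∈ ω} ∩ openConn x b) + δ := by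

  -- the star `F` and the event `R`
  set F : Finset (Sym2 (Fin n)) := T.image (fun a => s(x, a)) with hFdef
  have hF : ∀ e ∈ F, ∃ a, a ≠ x ∧ e = s(x, a) := by
    intro e he
    obtain ⟨a, haT, rfl⟩ := Finset.mem_image.1 he
    exact ⟨a, fun h => hxT (h ▸ haT), rfl⟩
  have hR : {ω : Set (Sym2 (Fin n)) | ∃ a ∈ T, s(x, a) ∈ ω} = {ω | ∃ e ∈ F, e ∈ ω} := by
    ext ω
    simp only [Set.mem_setOf_eq, hFdef, Finset.mem_image]
    constructor
    · rintro ⟨a, haT, ha⟩; exact ⟨s(x, a), ⟨a, haT, rfl⟩, ha⟩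
    · rintro ⟨e, ⟨a, haT, rfl⟩, he⟩; exact ⟨a, haT, he⟩
  rw [hR]
  set R : Set (Set (Sym2 (Fin n))) := {ω | ∃ e ∈ F, e ∈ ω} with hRdef
  -- base weighting `w⁰` (star removed) and the minimiser `c` of `τ⁰` over `{d} ∪ T`
  set w₀ : Sym2 (Fin n) → unitInterval := pinW w ↑F ↑(∅ : Finset (Sym2 (Fin n))) with hw₀
  set τ₀ : Fin n → ℝ := fun v => (prodBernoulli w₀).real (openConn v b) with hτ₀
  obtain ⟨c, hc, hcmin⟩ := Finset.exists_min_image (insert d T) τ₀ (Finset.insert_nonempty d T)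
  have hcT : ∀ a ∈ T, τ₀ c ≤ τ₀ a := fun a ha => hcmin a (Finset.mem_insert_of_mem ha)
  have hcd : τ₀ c ≤ τ₀ d := hcmin d (Finset.mem_insert_self d T)
  have hdc : (prodBernoulli w).real (openConn d b) ≤ (prodBernoulli w).real (openConn c b) + δ := by
    rcases Finset.mem_insert.1 hc with rfl | hcT'
    · exact le_add_of_nonneg_right hδ
    · exact hle c hcT'
  -- (i) CORE on every pattern meeting `R`
  have hcore : ∀ J : Finset (Sym2 (Fin n)), J ⊆ F → (↑J : Set (Sym2 (Fin n))) ∈ R →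
      (prodBernoulli (pinW w ↑F ↑J)).real (openConn c b) ≤
        (prodBernoulli (pinW w ↑F ↑J)).real (openConn x b) := by
    intro J hJF hJR
    obtain ⟨e, heF, heJ⟩ := hJR
    have heJ' : e ∈ J := Finset.mem_coe.1 heJ
    obtain ⟨a, hax, rfl⟩ := hF e heF
    have haT : a ∈ T := by
      obtain ⟨a', ha'T, he'⟩ := Finset.mem_image.1 heF
      rcases Sym2.eq_iff.1 he' with ⟨-, h⟩ | ⟨h, -⟩
      · exact h ▸ ha'T
      · exact (hax h.symm).elim
    exact multiEdge_core w hF hJF heJ' hax c b (hcT a haT)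
  -- law of total probability over the patterns of `F`, for `R` and for `Rᶜ`
  have hRm : MeasurableSet R := MeasurableSet.of_discrete
  have hdec := fun v : Fin n =>
    prodBernoulli_real_inter_eq_sum_pinW w F (A := openConn v b) (B := R) MeasurableSet.of_discrete
      (DepthOneGluing.determinedBy_exists_mem F)
  have hdecC := fun v : Fin n =>
    prodBernoulli_real_inter_eq_sum_pinW w F (A := openConn v b) (B := Rᶜ) MeasurableSet.of_discrete
      (determinedBy_forall_not_mem F)
  have hN : ∀ v : Fin n, (prodBernoulli w).real (openConn v b ∩ Rᶜ) =
      (prodBernoulli w).real (localCylinder ↑F ↑(∅ : Finset (Sym2 (Fin n)))) * τ₀ v := by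
    intro v
    rw [hdecC v]
    refine Finset.sum_eq_single_of_mem ∅ ?_ ?_
    · refine (@Finset.mem_filter _ _ (_) _ _).2 ⟨Finset.mem_powerset.2 (Finset.empty_subset F), ?_⟩
      rintro ⟨e, -, he⟩
      exact Finset.notMem_empty e (Finset.mem_coe.1 he)
    · intro J hJ hne
      exfalso
      obtain ⟨hJF, hno⟩ := (@Finset.mem_filter _ _ (_) _ _).1 hJ
      obtain ⟨e, heJ⟩ := Finset.nonempty_iff_ne_empty.2 hne
      exact hno ⟨e, Finset.mem_powerset.1 hJF heJ, Finset.mem_coe.2 heJ⟩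
  have hsplit : ∀ v : Fin n, (prodBernoulli w).real (openConn v b ∩ R) +
      (prodBernoulli w).real (openConn v b ∩ Rᶜ) = (prodBernoulli w).real (openConn v b) :=
    fun v => measureReal_inter_add_sdiff (μ := prodBernoulli w) (s := openConn v b) hRm
  -- (ii) `μ(c↔b, R) ≤ μ(x↔b, R)` termwise
  have hcx : (prodBernoulli w).real (openConn c b ∩ R) ≤ (prodBernoulli w).real (openConn x b ∩ R) := by
    rw [hdec c, hdec x]
    refine Finset.sum_le_sum fun J hJ => mul_le_mul_of_nonneg_left ?_ measureReal_nonneg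
    obtain ⟨hJF, hJR⟩ := (@Finset.mem_filter _ _ (_) _ _).1 hJ
    exact hcore J (Finset.mem_powerset.1 hJF) hJR
  -- (iii) `μ(d↔b, R) ≤ μ(c↔b, R)` from `τ(d) ≤ τ(c)` and `τ⁰(c) ≤ τ⁰(d)`
  have hdc' : (prodBernoulli w).real (openConn d b ∩ R) ≤ (prodBernoulli w).real (openConn c b ∩ R) + δ := by
    have hd := hsplit d
    have hc' := hsplit c
    rw [hN] at hd hc'
    have hmono : (prodBernoulli w).real (localCylinder ↑F ↑(∅ : Finset (Sym2 (Fin n)))) * τ₀ c ≤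
        (prodBernoulli w).real (localCylinder ↑F ↑(∅ : Finset (Sym2 (Fin n)))) * τ₀ d :=
      mul_le_mul_of_nonneg_left hcd measureReal_nonneg
    linarith
  rw [Set.inter_comm R (openConn d b), Set.inter_comm R (openConn x b)]
  linarith


/-- Registered rung `stub_multiEdgeLemma3Delta_b` of crux stmt-CriticalPhenomena-4576 (seat b): multi-edge Lemma 3 with flat slack —
`multiEdge_lemma3_delta`, closed statement. [cite: KozmaNitzan2024, Lemma 3(i) (pp. 6–7), Lemma 5 (p. 13)] -/
theorem stub_multiEdgeLemma3Delta_b : ∀ (n : ℕ) (w : Sym2 (Fin n) → unitInterval) (T : Finset (Fin n)) (x d b : Fin n) (δ : ℝ), x ∉ T → 0 ≤ δ → (∀ a ∈ T, (Literature.Probability.LatticeModels.prodBernoulli w).real (Literature.Probability.Percolation.openConn d b) ≤ (Literature.Probability.LatticeModels.prodBernoulli w).real (Literature.Probability.Percolation.openConn a b) + δ) → (Literature.Probability.LatticeModels.prodBernoulli w).real ({ω : Set (Sym2 (Fin n)) | ∃ a ∈ T, s(x, a) ∈ ω} ∩ Literature.Probability.Percolation.openConn d b) ≤ (Literature.Probability.LatticeModels.prodBernoulli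 w).real ({ω : Set (Sym2 (Fin n)) | ∃ a ∈ T, s(x, a) ∈ ω} ∩ Literature.Probability.Percolation.openConn x b) + δ :=
  fun _ w T x d b _ hxT hδ hle => multiEdge_lemma3_delta w x d b T hxT hδ hle

end MultiEdgeDelta

end

end Summit.CriticalPhenomena.PercolationContinuityZ3.Theorems
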